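import Summits.CriticalPhenomena.CardyFormulaZ2.Theorems.CardyRotToConfR2SymmetryUpgrade.Negative.CruxConsequences
import Literature.Probability.RandomPlanarGeometry.SLETwoPointItoProofs
import Literature.Probability.RandomPlanarGeometry.ConformalRectangleProofs
import Literature.Probability.RandomPlanarGeometry.CardyFunctionIncBeta
import Literature.Probability.RandomPlanarGeometry.LocalMartingaleProofs
import Literature.Probability.RandomPlanarGeometry.LatticeSimilarityCovariance

/-!
# drefute certificate: the crux-tied stubs of line `isotropy-kills-beltrami` are CONSEQUENCES of the crux
# (crux stmt-CriticalPhenomena-0698, `CardyRotToConfR2SymmetryUpgrade`)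

Kernel-checked support for the drefute verdict "S1, S3 and S0(a) cannot be refuted without refuting the crux":
* `s3_of_crux` — `stub_typedSchrammLSW` follows from the crux (it has the crux's hypotheses and one more);
* `s1_of_crux` — `stub_quasiUniformisation` follows from the crux with `Φ = Homeomorph.refl ℂ`, by
  `isConformallyCovariant_of_crux` (Negative/CruxConsequences, i.e. `IsSLELaw.conformalCovariance_holds`);
* `s0a_of_crux` — clause (a) of `stub_regularityFromAxioms` (crossing probabilities in `(0,1)`) follows from the crux by
  Cardy's formula for SLE₆, PROVED in the tree (`sle_six_measureReal_hitsBefore_holds`), a uniformizing datum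
  (`exists_isUniformizing_holds`), `crossRatio ∈ (0,1)`, and `0 = F(0) < F(η) < F(1) = 1`
  (`strictMonoOn_cardyFunction_holds`, `cardyFunction_zero`, `cardyFunction_one_holds`).
Clause (b) of S0 (two-sided instant boundary return of SLE₆ in every Jordan domain) is also a consequence of the crux on
paper (κ = 6 > 4: boundary hits of the `ℍ`-trace accumulate at `0` on both sides; Carathéodory homeomorphism), not
certified here.
-/

noncomputable section

open Set MeasureTheory Topology Filter
open scoped unitInterval ENNReal NNReal

namespace Summit.CriticalPhenomena.CardyFormulaZ2.Cruxes.CardyRotToConfR2SymmetryUpgrade.DrefuteStubsFromCrux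

open Literature.Probability.RandomPlanarGeometry
open Literature.Probability.RandomPlanarGeometry.ChordalFamily
open Summit.CriticalPhenomena.CardyFormulaZ2.Theses.CardyRotToConf
open Summit.CriticalPhenomena.CardyFormulaZ2.Theorems.CardyRotToConfR2SymmetryUpgrade.Negative

/-- The statement of stub S3 (`stub_typedSchrammLSW`), verbatim. [folklore] -/
def S3 : Prop :=
  ∀ Q : ChordalFamily, IsLocalMarkovChordalFamily Q →
    (∀ D : DobrushinDomain, ∀ᵐ γ ∂(Q D), ∀ c : Curve ℂ, CurveClass.mk c = γ →
      ∀ s t : unitInterval, s < t → c '' Set.Icc s t ⊆ frontier D.carrier →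
        (c '' Set.Icc s t).Subsingleton) →
    Q.IsConformallyCovariant →
    ∀ D : DobrushinDomain, IsSLELaw 6 D (Q D)

/-- The statement of stub S1 (`stub_quasiUniformisation`), verbatim. [folklore] -/
def S1 : Prop :=
  ∀ P : ChordalFamily, IsLocalMarkovChordalFamily P →
    (∀ D : DobrushinDomain, ∀ᵐ γ ∂(P D), ∀ c : Curve ℂ, CurveClass.mk c = γ →
      ∀ s t : unitInterval, s < t → c '' Set.Icc s t ⊆ frontier D.carrier →
        (c '' Set.Icc s t).Subsingleton) →
    (∀ R : ConformalRectangle, 0 < P (R.chord 0 2 (by decide)) (CurveClass.hitsBefore (R.arc 2) (R.arc 1)) ∧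
      P (R.chord 0 2 (by decide)) (CurveClass.hitsBefore (R.arc 2) (R.arc 1)) < 1) →
    (∀ D : DobrushinDomain, ∀ᵐ γ ∂(P D), ∀ ε : ℝ, 0 < ε → ∀ i : Fin 2,
      ∃ z ∈ γ.range ∩ D.arc i, z ≠ D.pt 0 ∧ dist z (D.pt 0) < ε) →
    ∃ Φ : ℂ ≃ₜ ℂ, ChordalFamily.IsConformallyCovariant
      (fun D : DobrushinDomain => (P (D.map Φ.symm)).map (CurveClass.map (Φ : C(ℂ, ℂ))))

/-- Clause (a) of stub S0 (`stub_regularityFromAxioms`): non-degenerate crossings. [folklore] -/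
def S0a : Prop :=
  ∀ P : ChordalFamily, IsLocalMarkovChordalFamily P →
    (∀ D : DobrushinDomain, ∀ᵐ γ ∂(P D), ∀ c : Curve ℂ, CurveClass.mk c = γ →
      ∀ s t : unitInterval, s < t → c '' Set.Icc s t ⊆ frontier D.carrier →
        (c '' Set.Icc s t).Subsingleton) →
    ∀ R : ConformalRectangle, 0 < P (R.chord 0 2 (by decide)) (CurveClass.hitsBefore (R.arc 2) (R.arc 1)) ∧
      P (R.chord 0 2 (by decide)) (CurveClass.hitsBefore (R.arc 2) (R.arc 1)) < 1

/-- **crux ⇒ S3** (S3 is the crux with an extra hypothesis). [folklore] -/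
theorem s3_of_crux (h : CardyRotToConfR2SymmetryUpgrade) : S3 :=
  fun Q hQ hNT _ D => h Q hQ hNT D

/-- `MarkedDomain.map` along the identity homeomorphism is the identity. [folklore] -/
theorem markedDomain_map_refl {n : ℕ} (D : MarkedDomain n) : D.map (Homeomorph.refl ℂ) = D :=
  MarkedDomain.ext (JordanDomain.ext (by simp) rfl) rfl

/-- `CurveClass.map` along the identity is the identity. [folklore] -/
theorem curveClassMap_refl : CurveClass.map ((Homeomorph.refl ℂ : ℂ ≃ₜ ℂ) : C(ℂ, ℂ)) = id := by
  funext c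
  obtain ⟨γ, rfl⟩ := CurveClass.surjective_mk c
  rw [CurveClass.map_mk, id]
  congr 1

/-- **crux ⇒ S1**, with the trivial uniformiser `Φ = id`: the conjugated family is `P` itself, which is conformally
covariant under the crux (`isConformallyCovariant_of_crux`). So S1 is refutable only by refuting the crux. [folklore] -/
theorem s1_of_crux (h : CardyRotToConfR2SymmetryUpgrade) : S1 := by
  intro P hP hNT _ _
  refine ⟨Homeomorph.refl ℂ, ?_⟩
  have hfam : (fun D : DobrushinDomain =>
      (P (D.map (Homeomorph.refl ℂ).symm)).map (CurveClass.map ((Homeomorph.refl ℂ : ℂ ≃ₜ ℂ) : C(ℂ, ℂ)))) = P := by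
    funext D
    rw [Homeomorph.refl_symm, markedDomain_map_refl, curveClassMap_refl, Measure.map_id]
  rw [hfam]
  exact isConformallyCovariant_of_crux h hP hNT

/-- **crux ⇒ S0(a)**: under the crux the law in `(R; x₀, x₂)` is the SLE₆ law, whose crossing probability is Cardy's
value `F(η) ∈ (0,1)` (`sle_six_measureReal_hitsBefore_holds`). [folklore] -/
theorem s0a_of_crux (h : CardyRotToConfR2SymmetryUpgrade) : S0a := by
  intro P hP hNT R
  haveI : Fact Literature.Probability.Process.isProjectiveLimit_preWienerMeasure :=
    ⟨isProjectiveLimit_preWienerMeasure_holds⟩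
  have hμ : IsSLELaw 6 (R.chord 0 2 (by decide)) (P (R.chord 0 2 (by decide))) := h P hP hNT _
  haveI : IsProbabilityMeasure (P (R.chord 0 2 (by decide))) := hμ.isProbabilityMeasure
  obtain ⟨φ, x, hφ⟩ := MarkedDomain.exists_isUniformizing_holds R
  have hcardy := sle_six_measureReal_hitsBefore_holds R hμ hφ
  have hη := ConformalRectangle.crossRatio_mem_Ioo_of_isUniformizing hφ
  have hF0 : 0 < cardyFunction (crossRatio x) := by
    have := strictMonoOn_cardyFunction_holds (⟨le_rfl, zero_le_one⟩ : (0 : ℝ) ∈ Icc 0 1)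
      ⟨hη.1.le, hη.2.le⟩ hη.1
    rwa [cardyFunction_zero] at this
  have hF1 : cardyFunction (crossRatio x) < 1 := by
    have := strictMonoOn_cardyFunction_holds ⟨hη.1.le, hη.2.le⟩
      (⟨zero_le_one, le_rfl⟩ : (1 : ℝ) ∈ Icc 0 1) hη.2
    rwa [cardyFunction_one_holds] at this
  set E := CurveClass.hitsBefore (R.arc 2) (R.arc 1)
  have hreal : (P (R.chord 0 2 (by decide))).real E = cardyFunction (crossRatio x) := hcardy
  constructor
  · rw [pos_iff_ne_zero]
    intro h0
    rw [measureReal_def, h0, ENNReal.toReal_zero] at hreal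
    linarith
  · have hlt : (P (R.chord 0 2 (by decide))).real E < 1 := hreal ▸ hF1
    rw [measureReal_def] at hlt
    have := (ENNReal.toReal_lt_toReal (measure_ne_top _ E) ENNReal.one_ne_top).1
      (by simpa using hlt)
    simpa using this

end Summit.CriticalPhenomena.CardyFormulaZ2.Cruxes.CardyRotToConfR2SymmetryUpgrade.DrefuteStubsFromCrux
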